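import Mathlib
import HarnessLib
import Summits.HubbardSuperconductivity.HubbardSuperconductivity.Theorems.KLProgrammeKLRegimeWickScaleFlowConservation
import Summits.HubbardSuperconductivity.HubbardSuperconductivity.Theorems.KLProgrammeKLRegimeWickBubbleChannelsGeneral
import Summits.HubbardSuperconductivity.HubbardSuperconductivity.Theorems.KLProgrammeKLRegimeEngineCovarianceResponseAtPoint
import Summits.HubbardSuperconductivity.HubbardSuperconductivity.Theorems.KLProgrammeKLRegimeEngineV8PairTransferExport2

/-!
# Route `KLProgramme` — ENGINE child gen 8 (stmt-HubbardSuperconductivity-20437 `KLRegimeEngineV17F2`), skeleton v2 class #5 rev 3 / (E2-F2): conservation and the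
# THREE-CHANNEL READING for a MEMBER carrier `e^{Δ_D}𝒢^K_Λ` with ANY scaling-invariant Wick covariance `D` — `klmc_map_scaling_carrier`, `klmc_kernel_carrier_eq_zero_of_*`,
# `klmc_carrier_mem_evenOdd_zero`, `klmc_memberCov_invariant`, **`klmc_vertexFn_dblFold_bubble_pairKernel_carrier`**
# (cell gate-hubbard-kl, seat hubbard-kl-k3c1-p1 g11, technique «composed-map remainder propagation»)

WHY.  The Riccati-defect sup `ξᵢ` of a member's flow (the one analytic input of the SIZES bundle of `pairTransferRelAt_succ_keyed` / `pairTransferRelRes_succ_keyed` besides the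
relative pieces) is the non-pp-ladder part of the BILINEAR Wick source of the member carrier `𝓜_Λ = e^{Δ_{D}}𝒢^K_Λ`, `D = softCovOf K ψ + C^K_{>Λ₁} − C^K_{>Λ}` (`…MemberFlow`).
The three-channel reading `vertexFn_dblFold_bubble_pairKernel_of_conserving` (p513192) applies to ANY even carrier obeying the four conservation selection rules; the real-cutoff
instance `…_wickActionR` is the Wick member `D = C^K_{≤Λ}`.  This file gives the GENERIC-COVARIANCE instance: for every `D` invariant under all non-zero vertex-compatible
charge scalings (`normalCovariance`s — hence every `softCovOf` — and `C^K_{>Λ}` are: `scalingWeight_normalCovariance_invariant`, `scalingWeight_covAboveCT_invariant`),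
the carrier `e^{Δ_D}𝒢^K_Λ` is invariant (`klmc_map_scaling_carrier`), hence even-charge / frequency / spin / momentum conserving (`klmc_kernel_carrier_eq_zero_of_*`), even
(`klmc_carrier_mem_evenOdd_zero`), and the three-channel reading holds for it with any two diagonal lines `(C₁, C₂)` — **`klmc_vertexFn_dblFold_bubble_pairKernel_carrier`**
(`= 2(βL²)⁻³(PP + PHd − PHx − 2·S62)` at general external pair frequencies).  `klmc_memberCov_invariant`: the member covariance of `…MemberFlow` qualifies.
Exact algebra over landed lemmas; nothing about the model's sizes is asserted; nothing asserts superconductivity.  0 kit.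
-/

noncomputable section

namespace Summit.HubbardSuperconductivity.HubbardSuperconductivity.Theorems.KLRegimeWick

set_option linter.dupNamespace false -- summit = problem name (single-conjunct summit), D-0017

open Literature.MathematicalPhysics.QuantumLattice GrassmannAlgebra Finset Matrix
open Literature.Probability.LatticeModels
open Summit.HubbardSuperconductivity.HubbardSuperconductivity.Theorems.TwoPointAssembly
open Summit.HubbardSuperconductivity.HubbardSuperconductivity.Theorems.KLProgrammeLegKernels
open Summit.HubbardSuperconductivity.HubbardSuperconductivity.Theorems.KLRegimeSplit

section Carrier

variable {L M : ℕ} [NeZero L] (β U μ : ℝ) (K : TrigPolyC4v)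

/-- **A carrier with a scaling-invariant Wick covariance is invariant** under every non-zero vertex-compatible scaling. -/
theorem klmc_map_scaling_carrier [NeZero M] {D : Matrix (HubbardFieldIdx L M) (HubbardFieldIdx L M) ℂ} (φ : FreqMomentum L M × Fin 2 → ℂ) (hφ : ∀ p, φ p ≠ 0)
    (hD : ∀ X Y, scalingWeight φ X * scalingWeight φ Y * D X Y = D X Y)
    (hV : ∀ k₁ k₂ k₃ k₄ : FreqMomentum L M,
      matsubaraInt M k₁.1 + matsubaraInt M k₃.1 = matsubaraInt M k₂.1 + matsubaraInt M k₄.1 ∧ k₁.2 + k₃.2 = k₂.2 + k₄.2 →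
        φ (k₁, 0) * φ (k₃, 1) = φ (k₂, 0) * φ (k₄, 1))
    (Λ : ℝ) :
    ExteriorAlgebra.map (LinearMap.mulLeft ℂ (scalingWeight φ)) (gaussConv ℂ D (hubbardEffectiveActionCT L M β U μ 0 K Λ)) =
      gaussConv ℂ D (hubbardEffectiveActionCT L M β U μ 0 K Λ) := by
  rw [map_scaling_gaussConv φ hD, map_scaling_hubbardEffectiveActionCT φ hφ hV]

/-- Selection rule under a non-zero vertex-compatible weight. -/
theorem klmc_kernel_carrier_eq_zero_of_weight_ne [NeZero M] {D : Matrix (HubbardFieldIdx L M) (HubbardFieldIdx L M) ℂ}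
    (φ : FreqMomentum L M × Fin 2 → ℂ) (hφ : ∀ p, φ p ≠ 0) (hD : ∀ X Y, scalingWeight φ X * scalingWeight φ Y * D X Y = D X Y)
    (hV : ∀ k₁ k₂ k₃ k₄ : FreqMomentum L M,
      matsubaraInt M k₁.1 + matsubaraInt M k₃.1 = matsubaraInt M k₂.1 + matsubaraInt M k₄.1 ∧ k₁.2 + k₃.2 = k₂.2 + k₄.2 →
        φ (k₁, 0) * φ (k₃, 1) = φ (k₂, 0) * φ (k₄, 1))
    (Λ : ℝ) {m : ℕ} {X : Fin m → HubbardFieldIdx L M} (hw : ∏ i, scalingWeight φ (X i) ≠ 1) :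
    kernel ℂ (gaussConv ℂ D (hubbardEffectiveActionCT L M β U μ 0 K Λ)) m X = 0 :=
  kernel_eq_zero_of_invariant ℂ (scalingWeight φ) (klmc_map_scaling_carrier β U μ K φ hφ hD hV Λ) hw

/-- Selection rule for weights `2^{g}`. -/
theorem klmc_kernel_carrier_eq_zero_of_twoPow [NeZero M] {D : Matrix (HubbardFieldIdx L M) (HubbardFieldIdx L M) ℂ}
    (hD : ∀ φ : FreqMomentum L M × Fin 2 → ℂ, (∀ p, φ p ≠ 0) → ∀ X Y, scalingWeight φ X * scalingWeight φ Y * D X Y = D X Y)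
    (g : FreqMomentum L M × Fin 2 → ℤ)
    (hg : ∀ k₁ k₂ k₃ k₄ : FreqMomentum L M,
      matsubaraInt M k₁.1 + matsubaraInt M k₃.1 = matsubaraInt M k₂.1 + matsubaraInt M k₄.1 ∧ k₁.2 + k₃.2 = k₂.2 + k₄.2 →
        g (k₁, 0) + g (k₃, 1) = g (k₂, 0) + g (k₄, 1))
    (Λ : ℝ) {m : ℕ} {X : Fin m → HubbardFieldIdx L M} (hX : ∑ i, (if (X i).2 = 0 then (1 : ℤ) else -1) * g (X i).1 ≠ 0) :
    kernel ℂ (gaussConv ℂ D (hubbardEffectiveActionCT L M β U μ 0 K Λ)) m X = 0 := by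
  refine klmc_kernel_carrier_eq_zero_of_weight_ne β U μ K (fun p => (2 : ℂ) ^ g p) (fun p => zpow_ne_zero _ two_ne_zero)
    (hD _ fun p => zpow_ne_zero _ two_ne_zero) (twoPow_compatible g hg) Λ ?_
  rw [prod_scalingWeight_two_zpow]
  intro h
  exact hX (two_zpow_injective (h.trans (zpow_zero (2 : ℂ)).symm))

/-- **CHARGE conservation** for the carrier. -/
theorem klmc_kernel_carrier_eq_zero_of_charge [NeZero M] {D : Matrix (HubbardFieldIdx L M) (HubbardFieldIdx L M) ℂ}
    (hD : ∀ φ : FreqMomentum L M × Fin 2 → ℂ, (∀ p, φ p ≠ 0) → ∀ X Y, scalingWeight φ X * scalingWeight φ Y * D X Y = D X Y)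
    (Λ : ℝ) {m : ℕ} {X : Fin m → HubbardFieldIdx L M} (hX : ∑ i, (if (X i).2 = 0 then (1 : ℤ) else -1) ≠ 0) :
    kernel ℂ (gaussConv ℂ D (hubbardEffectiveActionCT L M β U μ 0 K Λ)) m X = 0 :=
  klmc_kernel_carrier_eq_zero_of_twoPow β U μ K hD (fun _ => 1) (fun _ _ _ _ _ => rfl) Λ (by simpa using hX)

/-- **FREQUENCY conservation** for the carrier. -/
theorem klmc_kernel_carrier_eq_zero_of_freq [NeZero M] {D : Matrix (HubbardFieldIdx L M) (HubbardFieldIdx L M) ℂ}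
    (hD : ∀ φ : FreqMomentum L M × Fin 2 → ℂ, (∀ p, φ p ≠ 0) → ∀ X Y, scalingWeight φ X * scalingWeight φ Y * D X Y = D X Y)
    (Λ : ℝ) {m : ℕ} {X : Fin m → HubbardFieldIdx L M} (hX : ∑ i, (if (X i).2 = 0 then (1 : ℤ) else -1) * matsubaraInt M (X i).1.1.1 ≠ 0) :
    kernel ℂ (gaussConv ℂ D (hubbardEffectiveActionCT L M β U μ 0 K Λ)) m X = 0 :=
  klmc_kernel_carrier_eq_zero_of_twoPow β U μ K hD (fun p => matsubaraInt M p.1.1) (fun _ _ _ _ h => h.1) Λ hX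

/-- **SPIN conservation** for the carrier. -/
theorem klmc_kernel_carrier_eq_zero_of_spin [NeZero M] {D : Matrix (HubbardFieldIdx L M) (HubbardFieldIdx L M) ℂ}
    (hD : ∀ φ : FreqMomentum L M × Fin 2 → ℂ, (∀ p, φ p ≠ 0) → ∀ X Y, scalingWeight φ X * scalingWeight φ Y * D X Y = D X Y)
    (Λ : ℝ) {m : ℕ} {X : Fin m → HubbardFieldIdx L M} (hX : ∑ i, (if (X i).2 = 0 then (1 : ℤ) else -1) * (if (X i).1.2 = 0 then 1 else 0) ≠ 0) :
    kernel ℂ (gaussConv ℂ D (hubbardEffectiveActionCT L M β U μ 0 K Λ)) m X = 0 :=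
  klmc_kernel_carrier_eq_zero_of_twoPow β U μ K hD (fun p => if p.2 = 0 then 1 else 0) (fun _ _ _ _ _ => by simp) Λ hX

/-- **MOMENTUM conservation** for the carrier, coordinate by coordinate. -/
theorem klmc_kernel_carrier_eq_zero_of_momentum [NeZero M] {D : Matrix (HubbardFieldIdx L M) (HubbardFieldIdx L M) ℂ}
    (hD : ∀ φ : FreqMomentum L M × Fin 2 → ℂ, (∀ p, φ p ≠ 0) → ∀ X Y, scalingWeight φ X * scalingWeight φ Y * D X Y = D X Y)
    (Λ : ℝ) {m : ℕ} {X : Fin m → HubbardFieldIdx L M} (j : Fin 2) (hX : ∑ i, (if (X i).2 = 0 then (1 : ℤ) else -1) • (X i).1.1.2 j ≠ 0) :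
    kernel ℂ (gaussConv ℂ D (hubbardEffectiveActionCT L M β U μ 0 K Λ)) m X = 0 := by
  refine klmc_kernel_carrier_eq_zero_of_weight_ne β U μ K (fun p => (ZMod.stdAddChar (p.1.2 j) : ℂ)) (fun p => stdAddChar_ne_zero _)
    (hD _ fun p => stdAddChar_ne_zero _) (fun k₁ k₂ k₃ k₄ h => ?_) Λ ?_
  · rw [← AddChar.map_add_eq_mul, ← AddChar.map_add_eq_mul, ← Pi.add_apply k₁.2, ← Pi.add_apply k₂.2, h.2]
  · have hw : ∏ i, scalingWeight (fun p => (ZMod.stdAddChar (p.1.2 j) : ℂ)) (X i) =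
        ZMod.stdAddChar (∑ i, (if (X i).2 = 0 then (1 : ℤ) else -1) • (X i).1.1.2 j) := by
      rw [addChar_map_sum]
      refine Finset.prod_congr rfl fun i _ => ?_
      rw [scalingWeight_eq_zpow, AddChar.map_zsmul_eq_zpow]
    rw [hw]
    intro h
    apply hX
    exact ZMod.injective_stdAddChar (h.trans (AddChar.map_zero_eq_one _).symm)

/-- **The carrier is even.** -/
theorem klmc_carrier_mem_evenOdd_zero (D : Matrix (HubbardFieldIdx L M) (HubbardFieldIdx L M) ℂ) (Λ : ℝ) :
    gaussConv ℂ D (hubbardEffectiveActionCT L M β U μ 0 K Λ) ∈ evenOdd ℂ 0 :=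
  gaussConv_mem_evenOdd ℂ _ (klws_effectiveActionR_mem_evenOdd_zero β U μ K Λ)

omit [NeZero L] in
/-- **The member covariance of `…MemberFlow` is scaling-invariant**: `softCovOf K ψ + C^K_{>Λ₁} − C^K_{>Λ}` (a `normalCovariance` plus two hard covariances). -/
theorem klmc_memberCov_invariant [NeZero M] (ψ : FreqMomentum L M → ℝ) (Λ₁ Λ : ℝ) (φ : FreqMomentum L M × Fin 2 → ℂ) (hφ : ∀ p, φ p ≠ 0)
    (X Y : HubbardFieldIdx L M) :
    scalingWeight φ X * scalingWeight φ Y * (softCovOf L M β μ K ψ + hubbardCovAboveCT L M β μ 0 K Λ₁ - hubbardCovAboveCT L M β μ 0 K Λ) X Y =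
      (softCovOf L M β μ K ψ + hubbardCovAboveCT L M β μ 0 K Λ₁ - hubbardCovAboveCT L M β μ 0 K Λ) X Y := by
  simp only [Matrix.add_apply, Matrix.sub_apply, mul_add, mul_sub, scalingWeight_covAboveCT_invariant φ hφ]
  rw [softCovOf, EngineV8.scalingWeight_normalCovariance_invariant φ hφ]

variable [NeZero M]

/-- **THE THREE-CHANNEL READING FOR A CARRIER WITH SCALING-INVARIANT WICK COVARIANCE** (instance of `vertexFn_dblFold_bubble_pairKernel_of_conserving`): for diagonal lines
`C₁, C₂` (values `ℓ₁, ℓ₂`) at the pair labels with general external frequencies, `𝒱₄(dblFold(Δ_×(C₁)(Δ_×(C₂)(𝓜⁰·𝓜¹))))(Z) = 2(βL²)⁻³(PP + PHd − PHx − 2·S62)` with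
`𝓜 = e^{Δ_D}𝒢^K_Λ`. -/
theorem klmc_vertexFn_dblFold_bubble_pairKernel_carrier (hβ : β ≠ 0) {D : Matrix (HubbardFieldIdx L M) (HubbardFieldIdx L M) ℂ}
    (hD : ∀ φ : FreqMomentum L M × Fin 2 → ℂ, (∀ p, φ p ≠ 0) → ∀ X Y, scalingWeight φ X * scalingWeight φ Y * D X Y = D X Y)
    {C₁ C₂ : Matrix (HubbardFieldIdx L M) (HubbardFieldIdx L M) ℂ}
    {ℓ₁ ℓ₂ : FreqMomentum L M → ℂ} (h₁ : contr ℂ C₁ = diagContr L M ℓ₁) (h₂ : contr ℂ C₂ = diagContr L M ℓ₂) (Λ : ℝ) (Q : TorusSite 2 L)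
    (x y : TorusSite 2 L × MatsubaraIdx M) :
    vertexFn L M β (dblFold ℂ (grassmannLaplacian ℂ (crossCov ℂ C₁) (grassmannLaplacian ℂ (crossCov ℂ C₂)
        (dblCopy ℂ 0 (gaussConv ℂ D (hubbardEffectiveActionCT L M β U μ 0 K Λ)) *
          dblCopy ℂ 1 (gaussConv ℂ D (hubbardEffectiveActionCT L M β U μ 0 K Λ)))))) 4
        ![(((y.2, y.1), 0), 0), (((y.2.rev, Q - y.1), 1), 0), (((x.2.rev, Q - x.1), 1), 1), (((x.2, x.1), 0), 1)] =
      2 * ((((β * (L : ℝ) ^ 2 : ℝ) : ℂ)) ^ 3)⁻¹ *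
        ((∑ z : TorusSite 2 L × MatsubaraIdx M,
            (ℓ₂ (z.2, z.1) * ℓ₁ (z.2.rev, Q - z.1) + ℓ₁ (z.2, z.1) * ℓ₂ (z.2.rev, Q - z.1)) *
              (vertexFn L M β (gaussConv ℂ D (hubbardEffectiveActionCT L M β U μ 0 K Λ)) 4
                  ![(((z.2, z.1), 0), 0), (((z.2.rev, Q - z.1), 1), 0), (((x.2.rev, Q - x.1), 1), 1), (((x.2, x.1), 0), 1)] *
                vertexFn L M β (gaussConv ℂ D (hubbardEffectiveActionCT L M β U μ 0 K Λ)) 4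
                  ![(((y.2, y.1), 0), 0), (((y.2.rev, Q - y.1), 1), 0), (((z.2.rev, Q - z.1), 1), 1), (((z.2, z.1), 0), 1)])) +
          (∑ p : FreqMomentum L M, ∑ σ : Fin 2, ∑ p' : FreqMomentum L M,
            if matsubaraInt M p'.1 + matsubaraInt M y.2 = matsubaraInt M p.1 + matsubaraInt M x.2 ∧ p'.2 = p.2 + x.1 - y.1 then
              (ℓ₂ p * ℓ₁ p' + ℓ₁ p * ℓ₂ p') *
                (vertexFn L M β (gaussConv ℂ D (hubbardEffectiveActionCT L M β U μ 0 K Λ)) 4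
                    ![((p, σ), 1), ((p', σ), 0), (((y.2, y.1), 0), 0), (((x.2, x.1), 0), 1)] *
                  vertexFn L M β (gaussConv ℂ D (hubbardEffectiveActionCT L M β U μ 0 K Λ)) 4
                    ![((p, σ), 0), ((p', σ), 1), (((y.2.rev, Q - y.1), 1), 0), (((x.2.rev, Q - x.1), 1), 1)])
            else 0) -
          (∑ p : FreqMomentum L M, ∑ p' : FreqMomentum L M,
            if matsubaraInt M p'.1 + matsubaraInt M x.2 + matsubaraInt M y.2 + 1 = matsubaraInt M p.1 ∧ p'.2 = p.2 + Q - x.1 - y.1 then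
              (ℓ₂ p * ℓ₁ p' + ℓ₁ p * ℓ₂ p') *
                (vertexFn L M β (gaussConv ℂ D (hubbardEffectiveActionCT L M β U μ 0 K Λ)) 4
                    ![((p, 0), 1), ((p', 1), 0), (((y.2, y.1), 0), 0), (((x.2.rev, Q - x.1), 1), 1)] *
                  vertexFn L M β (gaussConv ℂ D (hubbardEffectiveActionCT L M β U μ 0 K Λ)) 4
                    ![((p, 0), 0), ((p', 1), 1), (((y.2.rev, Q - y.1), 1), 0), (((x.2, x.1), 0), 1)])
            else 0) -
          2 * ∑ p : FreqMomentum L M, ∑ σ : Fin 2, ℓ₁ p * ℓ₂ p *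
            (vertexFn L M β (gaussConv ℂ D (hubbardEffectiveActionCT L M β U μ 0 K Λ)) 6
                ![((p, σ), 0), ((p, σ), 1), (((y.2, y.1), 0), 0), (((y.2.rev, Q - y.1), 1), 0), (((x.2.rev, Q - x.1), 1), 1),
                  (((x.2, x.1), 0), 1)] *
              selfEnergy L M β (gaussConv ℂ D (hubbardEffectiveActionCT L M β U μ 0 K Λ)) p σ)) :=
  vertexFn_dblFold_bubble_pairKernel_of_conserving β _ hβ (klmc_carrier_mem_evenOdd_zero β U μ K D Λ)
    (fun _ _ h => klmc_kernel_carrier_eq_zero_of_charge β U μ K hD Λ h) (fun _ _ h => klmc_kernel_carrier_eq_zero_of_freq β U μ K hD Λ h)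
    (fun _ _ h => klmc_kernel_carrier_eq_zero_of_spin β U μ K hD Λ h) (fun _ _ j h => klmc_kernel_carrier_eq_zero_of_momentum β U μ K hD Λ j h)
    h₁ h₂ Q x y

/-- **The Riccati split of the bilinear Wick source of the carrier** (twin of `klws_source_split` for ANY scaling-invariant Wick covariance `D`, lines `C₁` (values `ℓ₁`) and
`D` (values `ℓ₂`)): `−½·𝒱₄(dblFold(Δ_×(C₁)(e^{Δ_×(D)}(𝓜⁰𝓜¹))))(Z(x,y)) = −(βL²)⁻³·Σ_z λ(z)·K(x,z)·K(z,y) + (−½·𝒱₄(dblFold(Δ_×(C₁)((e^{Δ_×(D)} − Δ_×(D))(𝓜⁰𝓜¹))))(Z) − (βL²)⁻³·(PHd − PHx − 2·S62))`,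
`λ(z) = ℓ₂(p)ℓ₁(p̄) + ℓ₁(p)ℓ₂(p̄)`, `K = 𝒱₄(𝓜)` at the pair labels — the pp-LADDER term isolated; everything else is the member's source `X`. -/
theorem klmc_source_split (hβ : β ≠ 0) {D C₁ : Matrix (HubbardFieldIdx L M) (HubbardFieldIdx L M) ℂ}
    (hD : ∀ φ : FreqMomentum L M × Fin 2 → ℂ, (∀ p, φ p ≠ 0) → ∀ X Y, scalingWeight φ X * scalingWeight φ Y * D X Y = D X Y)
    {ℓ₁ ℓ₂ : FreqMomentum L M → ℂ} (h₁ : contr ℂ C₁ = diagContr L M ℓ₁) (h₂ : contr ℂ D = diagContr L M ℓ₂) (Λ : ℝ) (Q : TorusSite 2 L)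
    (x y : TorusSite 2 L × MatsubaraIdx M) :
    -((2 : ℂ)⁻¹ * vertexFn L M β (dblFold ℂ (grassmannLaplacian ℂ (crossCov ℂ C₁)
        (gaussConv ℂ (crossCov ℂ D) (dblCopy ℂ 0 (gaussConv ℂ D (hubbardEffectiveActionCT L M β U μ 0 K Λ)) * dblCopy ℂ 1 (gaussConv ℂ D (hubbardEffectiveActionCT L M β U μ 0 K Λ)))))) 4
        ![(((y.2, y.1), 0), 0), (((y.2.rev, Q - y.1), 1), 0), (((x.2.rev, Q - x.1), 1), 1), (((x.2, x.1), 0), 1)]) =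
      -(((((β * (L : ℝ) ^ 2 : ℝ) : ℂ)) ^ 3)⁻¹ *
          (∑ z : TorusSite 2 L × MatsubaraIdx M,
            (ℓ₂ (z.2, z.1) * ℓ₁ (z.2.rev, Q - z.1) + ℓ₁ (z.2, z.1) * ℓ₂ (z.2.rev, Q - z.1)) *
              (vertexFn L M β (gaussConv ℂ D (hubbardEffectiveActionCT L M β U μ 0 K Λ)) 4
                  ![(((z.2, z.1), 0), 0), (((z.2.rev, Q - z.1), 1), 0), (((x.2.rev, Q - x.1), 1), 1), (((x.2, x.1), 0), 1)] *
                vertexFn L M β (gaussConv ℂ D (hubbardEffectiveActionCT L M β U μ 0 K Λ)) 4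
                  ![(((y.2, y.1), 0), 0), (((y.2.rev, Q - y.1), 1), 0), (((z.2.rev, Q - z.1), 1), 1), (((z.2, z.1), 0), 1)]))) +
      (-((2 : ℂ)⁻¹ * vertexFn L M β (dblFold ℂ (grassmannLaplacian ℂ (crossCov ℂ C₁)
          ((gaussConv ℂ (crossCov ℂ D) - grassmannLaplacian ℂ (crossCov ℂ D))
            (dblCopy ℂ 0 (gaussConv ℂ D (hubbardEffectiveActionCT L M β U μ 0 K Λ)) * dblCopy ℂ 1 (gaussConv ℂ D (hubbardEffectiveActionCT L M β U μ 0 K Λ)))))) 4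
          ![(((y.2, y.1), 0), 0), (((y.2.rev, Q - y.1), 1), 0), (((x.2.rev, Q - x.1), 1), 1), (((x.2, x.1), 0), 1)]) -
        ((((β * (L : ℝ) ^ 2 : ℝ) : ℂ)) ^ 3)⁻¹ *
          ((∑ p : FreqMomentum L M, ∑ σ : Fin 2, ∑ p' : FreqMomentum L M,
            if matsubaraInt M p'.1 + matsubaraInt M y.2 = matsubaraInt M p.1 + matsubaraInt M x.2 ∧ p'.2 = p.2 + x.1 - y.1 then
              (ℓ₂ p * ℓ₁ p' + ℓ₁ p * ℓ₂ p') *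
                (vertexFn L M β (gaussConv ℂ D (hubbardEffectiveActionCT L M β U μ 0 K Λ)) 4
                    ![((p, σ), 1), ((p', σ), 0), (((y.2, y.1), 0), 0), (((x.2, x.1), 0), 1)] *
                  vertexFn L M β (gaussConv ℂ D (hubbardEffectiveActionCT L M β U μ 0 K Λ)) 4
                    ![((p, σ), 0), ((p', σ), 1), (((y.2.rev, Q - y.1), 1), 0), (((x.2.rev, Q - x.1), 1), 1)])
            else 0) -
          (∑ p : FreqMomentum L M, ∑ p' : FreqMomentum L M,
            if matsubaraInt M p'.1 + matsubaraInt M x.2 + matsubaraInt M y.2 + 1 = matsubaraInt M p.1 ∧ p'.2 = p.2 + Q - x.1 - y.1 then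
              (ℓ₂ p * ℓ₁ p' + ℓ₁ p * ℓ₂ p') *
                (vertexFn L M β (gaussConv ℂ D (hubbardEffectiveActionCT L M β U μ 0 K Λ)) 4
                    ![((p, 0), 1), ((p', 1), 0), (((y.2, y.1), 0), 0), (((x.2.rev, Q - x.1), 1), 1)] *
                  vertexFn L M β (gaussConv ℂ D (hubbardEffectiveActionCT L M β U μ 0 K Λ)) 4
                    ![((p, 0), 0), ((p', 1), 1), (((y.2.rev, Q - y.1), 1), 0), (((x.2, x.1), 0), 1)])
            else 0) -
          2 * ∑ p : FreqMomentum L M, ∑ σ : Fin 2, ℓ₁ p * ℓ₂ p *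
            (vertexFn L M β (gaussConv ℂ D (hubbardEffectiveActionCT L M β U μ 0 K Λ)) 6
                ![((p, σ), 0), ((p, σ), 1), (((y.2, y.1), 0), 0), (((y.2.rev, Q - y.1), 1), 0), (((x.2.rev, Q - x.1), 1), 1),
                  (((x.2, x.1), 0), 1)] *
              selfEnergy L M β (gaussConv ℂ D (hubbardEffectiveActionCT L M β U μ 0 K Λ)) p σ))) := by
  -- split `e^{Δ_×(D)} = (e^{Δ_×(D)} − Δ_×(D)) + Δ_×(D)` and read the two-line class by the carrier's three-channel identity
  set P := dblCopy ℂ 0 (gaussConv ℂ D (hubbardEffectiveActionCT L M β U μ 0 K Λ)) * dblCopy ℂ 1 (gaussConv ℂ D (hubbardEffectiveActionCT L M β U μ 0 K Λ)) with hP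
  have hsplit : gaussConv ℂ (crossCov ℂ D) P =
      (gaussConv ℂ (crossCov ℂ D) - grassmannLaplacian ℂ (crossCov ℂ D)) P + grassmannLaplacian ℂ (crossCov ℂ D) P := by
    rw [LinearMap.sub_apply, sub_add_cancel]
  have h2 := klmc_vertexFn_dblFold_bubble_pairKernel_carrier β U μ K hβ hD h₁ h₂ Λ Q x y
  rw [hsplit, map_add, map_add, vertexFn_add, h2]
  ring

end Carrier

end Summit.HubbardSuperconductivity.HubbardSuperconductivity.Theorems.KLRegimeWick

end
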